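import Summits.ResolutionOfSingularities.ResolutionOfSingularities.Theorems.EquisingularLiftEquisingularLiftNatDeterminantalLiftNose
import Summits.ResolutionOfSingularities.ResolutionOfSingularities.Theorems.EquisingularLiftEquisingularLiftNatCompleteIntersectionLiftKey
import Summits.ResolutionOfSingularities.ResolutionOfSingularities.Theorems.EquisingularLiftEquisingularLiftNatCompleteIntersectionLiftSmooth
import HarnessLib

/-!
# [OURS · L1 W4.5(b) · EL♮(3)] T-DET-PROJ, part 3 (DOWNSTAIRS): a SMOOTH determinantal `Σ = V₊(I_t(M)) ⊂ ℙⁿ_k` — prime stalks,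
# `V((Δ)~)` regular and smooth over `k`, and the hKEY exactness `(Δ)~ = 𝓘_Σ` — by Eagon–Northcott at each point

Cell `res-hironaka`, rung L, slot W4.5(b); crux **EL♮(3)** (stmt-ResolutionOfSingularities-20148), rung v6′ «DET-nose» (res-L1-w45b-lead-2,
plan AGREED 2026-08-27T09:57:46Z). OURS; NOT a statement of any manuscript; AI-written, weaker than expert review. No definition, no `sorry`,
standard axioms. `--supports stmt-ResolutionOfSingularities-20148 --as helper`. Parts 1–2: `…NatDeterminantalLiftAlgebra` (p521649, ring core
with a uniformiser), `…NatDeterminantalLiftNose` (p523002, the lifted nose is regular and `O`-flat). This part is the `ϖ`-free twin needed ON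
THE SPECIAL FIBRE: the same Eagon–Northcott argument inside the regular local rings `𝒪_{ℙⁿ_k,y}`. PATTERN (adapted, cited): res-D-pv-027's T2b
`…NatCompleteIntersectionLiftKey` (p521354) and res-type-051's T4 `…NatCompleteIntersectionLiftSmooth` (p521509) for the complete-intersection nose —
their generic lemmas (`eq_vanishingIdeal_support_of_forall_radical_le`, `support_projIdealSheaf_span`, `mem_asHomogeneousIdeal_of_mem_support_projIdealSheaf`,
`exists_X_not_mem`, `downstairs_stalk_of_jacobian`) are consumed BY NAME.

* §1 `minorsIdeal_pair_package_of_linearIndependent` — `R` regular local, `m` a `(t+1) × t` matrix with `I_t(m) ⊆ 𝔪`, `F₀, F₁ ∈ I_t(m) ∩ 𝔪`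
  with linearly independent images in `𝔪/𝔪²` ⇒ **`I_t(m) = (F₀, F₁)`, prime, with regular quotient** (part 1's argument without `ϖ`, one
  packaged statement: chain `⊥ < (F₀) < (F₀,F₁)` + Eagon–Northcott `height ≤ 2` + Mathlib `Ideal.eq_of_le_of_height_le`).
* §2 On `ℙⁿ_k` (`k` a field), for a `(t+1) × t` matrix `M` of polynomials with row-deleted maximal minors `Δ_l` forms of degrees `D_l`, under the
  stalk-level PAIR hypothesis (J′-pair) «at `y ∈ supp (Δ)~` some chart `D₊(x_i) ∋ y` and minors `Δ_a, Δ_b` have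
  `c₀·germ(Δ_a/x_i^{D_a}) + c₁·germ(Δ_b/x_i^{D_b}) ∈ 𝔪_y² ⇒ c₀, c₁ ∈ 𝔪_y`»:
  `isPrime_stalkIdeal_projIdealSheaf_rowMinors` (the stalk `(Δ)~_y = I_t(germ matrix)` is PRIME with REGULAR quotient),
  `isRegular_subscheme_projIdealSheaf_rowMinors` (`V((Δ)~)` is a regular scheme), `smooth_subschemeι_projIdealSheaf_rowMinors`
  (`V((Δ)~) → Spec k` smooth, `k` perfect; Stacks 00TV), **`projIdealSheaf_rowMinors_eq_vanishingIdeal`** (hKEY: `(Δ)~ = 𝓘_Σ`,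
  `Σ = {y | ∀ l, Δ_l ∈ 𝔮_y}`), and `pairDown_of_jacobianPair` — (J′-pair) from the polynomial-level JACOBIAN-PAIR clause
  «∀ y ∈ Σ ∃ a b (e : Fin 2 ↪ Fin (n+1)), det (∂(Δ_a,Δ_b)/∂(x_{e 0},x_{e 1})) ∉ 𝔮_y» via res-type-051's CI-JAC `downstairs_stalk_of_jacobian`
  with `c = 2` (Euler's identity lives there).

References: H. Matsumura, *Commutative Ring Theory* (1986), Thm. 13.10, Thms. 14.2–14.3, Thm. 30.4 [Matsumura1987]; R. Hartshorne, *Algebraic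
Geometry* (1977), II Prop. 5.9, Cor. 5.16 [Hartshorne1977]; Stacks 00TV [StacksProject]; cell: LEAD-MEMO-5 §B (OURS).
-/

set_option linter.dupNamespace false -- mandated namespace `Summit.<Summit>.<Problem>` of this single-conjunct summit

noncomputable section

open CategoryTheory AlgebraicGeometry TopologicalSpace IsLocalRing Opposite
open MvPolynomial HomogeneousLocalization
open Literature.AlgebraicGeometry.Resolution
open Literature.RingTheory.KrullDimension
open Summit.ResolutionOfSingularities.ResolutionOfSingularities.Cruxes.EquisingularLift.StrataSplit

attribute [local instance] MvPolynomial.gradedAlgebra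

namespace Summit.ResolutionOfSingularities.ResolutionOfSingularities.Cruxes.EquisingularLiftNat.Sections

namespace DetLift

universe u

/-! ## §1 Ring core without a uniformiser: `I_t(m) = (F₀, F₁)` from cotangent independence -/

section LinIndep

variable {R : Type u} [CommRing R] [IsRegularLocalRing R] {t : ℕ} (m : Matrix (Fin (t + 1)) (Fin t) R)
  {F : Fin 2 → R} (hF : ∀ i, F i ∈ maximalIdeal R)
  (hli : LinearIndependent (ResidueField R) fun i => (maximalIdeal R).toCotangent ⟨F i, hF i⟩)
  (hFm : ∀ i, F i ∈ minorsIdeal t m) (hm : minorsIdeal t m ≤ maximalIdeal R)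

include hli hFm hm in
/-- **The `ϖ`-free Eagon–Northcott package: `I_t(m) = (F₀, F₁)`, `I_t(m)` is PRIME, and `R / I_t(m)` is a REGULAR local ring** — for `R`
regular local, `m` a `(t+1) × t` matrix with `I_t(m) ⊆ 𝔪`, and `F₀, F₁ ∈ I_t(m) ∩ 𝔪` with linearly independent images in `𝔪/𝔪²`
(the twin of part 1's `minorsIdeal_eq_span_of_cotangentLift` without a uniformiser, packaged as one statement): the chain of primes
`⊥ < (F₀) < (F₀, F₁)` (Literature `not_mem_span_image_of_linearIndependent_toCotangent` / `isPrime_span_image_of_linearIndependent_toCotangent`)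
gives height `≥ 2`, Eagon–Northcott gives `ht I_t(m) ≤ 2` (part 1 `minorsIdeal_eq_of_isPrime_le`), and Matsumura 14.2
(`CILift.isRegularLocalRing_quotient_span_image`) gives the regular quotient. [cite: Matsumura1987, Thm. 13.10 with Thms. 14.2–14.3] -/
theorem minorsIdeal_pair_package_of_linearIndependent :
    minorsIdeal t m = Ideal.span (Set.range F) ∧ (minorsIdeal t m).IsPrime ∧ IsRegularLocalRing (R ⧸ minorsIdeal t m) := by
  haveI : IsDomain R := isDomain_of_isRegularLocalRing R
  have hp1 : (Ideal.span {F 0}).IsPrime := by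
    have h := isPrime_span_image_of_linearIndependent_toCotangent F hF hli {0}
    rwa [Set.image_singleton] at h
  haveI hp2 : (Ideal.span (Set.range F)).IsPrime := by
    have h := isPrime_span_image_of_linearIndependent_toCotangent F hF hli Set.univ
    rwa [Set.image_univ] at h
  -- height `≥ 2`: the chain `⊥ < (F₀) < (F₀, F₁)`
  have h0 : F 0 ≠ 0 := by
    have h := not_mem_span_image_of_linearIndependent_toCotangent F hF hli 0 ∅ (Set.notMem_empty _)
    rw [Set.image_empty, Ideal.span_empty] at h
    exact fun h0 => h (h0 ▸ Ideal.zero_mem _)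
  have h1 : F 1 ∉ Ideal.span {F 0} := by
    have h := not_mem_span_image_of_linearIndependent_toCotangent F hF hli 1 {0} (by simp)
    rwa [Set.image_singleton] at h
  have hlt1 : (⊥ : Ideal R) < Ideal.span {F 0} := by
    rw [bot_lt_iff_ne_bot, ne_eq, Ideal.span_singleton_eq_bot]
    exact h0
  have hlt2 : Ideal.span {F 0} < Ideal.span (Set.range F) := by
    refine lt_of_le_of_ne (Ideal.span_mono (by rintro _ rfl; exact ⟨0, rfl⟩)) fun heq => ?_
    have : F 1 ∈ Ideal.span {F 0} := by rw [heq]; exact Ideal.subset_span ⟨1, rfl⟩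
    exact h1 this
  haveI : (⊥ : Ideal R).IsPrime := Ideal.isPrime_bot
  haveI := hp1
  have h1' : (1 : ℕ∞) ≤ (Ideal.span {F 0}).height := by
    have h := Ideal.height_add_one_le_of_lt_of_isPrime hlt1
    rw [Ideal.height_bot, zero_add] at h
    exact h
  have h2' := Ideal.height_add_one_le_of_lt_of_isPrime hlt2
  have hheight : 2 ≤ (Ideal.span (Set.range F)).height :=
    calc (2 : ℕ∞) = 1 + 1 := by norm_num
      _ ≤ (Ideal.span {F 0}).height + 1 := by gcongr
      _ ≤ _ := h2'
  -- Eagon–Northcott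
  have heq : minorsIdeal t m = Ideal.span (Set.range F) := by
    refine minorsIdeal_eq_of_isPrime_le m (Ideal.span_le.mpr ?_) ?_ hheight
    · rintro _ ⟨i, rfl⟩; exact hFm i
    · exact fun htop => (maximalIdeal.isMaximal R).ne_top (top_le_iff.mp (htop ▸ hm))
  refine ⟨heq, heq ▸ hp2, ?_⟩
  rw [heq]
  have h := CILift.isRegularLocalRing_quotient_span_image F hF hli Set.univ
  rwa [Set.image_univ] at h

end LinIndep

/-! ## §2 The smooth determinantal scheme on `ℙⁿ_k` -/

section Downstairs

variable {k : Type} [Field k] {n t : ℕ}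
  (M : Matrix (Fin (t + 1)) (Fin t) (MvPolynomial (Fin (n + 1)) k))
  (Δ : Fin (t + 1) → MvPolynomial (Fin (n + 1)) k) (hΔdef : ∀ l, Δ l = (M.submatrix l.succAbove id).det)
  (D : Fin (t + 1) → ℕ) (hΔ : ∀ l, Δ l ∈ homogeneousSubmodule (Fin (n + 1)) k (D l))

include hΔdef in
/-- **Prime stalk with regular quotient under (J′-pair).** At `y ∈ supp (Δ)~` with a chart `D₊(x_i) ∋ y` and a pair of maximal minors
`Δ_a, Δ_b` whose dehomogenised germs have independent differentials at `y`, the stalk `(Δ)~_y` — which is `I_t` of the germ matrix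
(part 2 `stalkIdeal_projIdealSheaf_rowMinors`) — equals `(germ Δ_a/x_i^{D_a}, germ Δ_b/x_i^{D_b})`, is PRIME, and `𝒪_{ℙⁿ_k,y}/(Δ)~_y` is a
REGULAR local ring (§1 in the regular local ring `𝒪_{ℙⁿ_k,y}`, Literature `isRegular_projectiveSpace`).
[cite: Matsumura1987, Thm. 13.10 and Thm. 14.2] -/
theorem isPrime_stalkIdeal_projIdealSheaf_rowMinors (y : Proj (homogeneousSubmodule (Fin (n + 1)) k))
    (hy : y ∈ (projIdealSheaf (homogeneousSubmodule (Fin (n + 1)) k)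
      ⟨Ideal.span (Set.range Δ), isHomogeneous_span_of_forall_mem _ Δ D hΔ⟩).support)
    (i : Fin (n + 1)) (hyi : y ∈ Proj.basicOpen (homogeneousSubmodule (Fin (n + 1)) k) (X i)) (a b : Fin (t + 1))
    (hJy : ∀ c : Fin 2 → (Proj (homogeneousSubmodule (Fin (n + 1)) k)).presheaf.stalk y,
      ∑ l, c l * ((Proj (homogeneousSubmodule (Fin (n + 1)) k)).presheaf.germ
          (Proj.basicOpen (homogeneousSubmodule (Fin (n + 1)) k) (X i)) y hyi).hom
        ((Proj.awayToSection (homogeneousSubmodule (Fin (n + 1)) k) (X i)).hom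
          (mk₁ (homogeneousSubmodule (Fin (n + 1)) k) (CILift.X_mem_one' i) (D (![a, b] l))
            (Δ (![a, b] l)) (hΔ (![a, b] l)))) ∈
        maximalIdeal ((Proj (homogeneousSubmodule (Fin (n + 1)) k)).presheaf.stalk y) ^ 2 →
      ∀ l, c l ∈ maximalIdeal ((Proj (homogeneousSubmodule (Fin (n + 1)) k)).presheaf.stalk y)) :
    (stalkIdeal (projIdealSheaf (homogeneousSubmodule (Fin (n + 1)) k)
        ⟨Ideal.span (Set.range Δ), isHomogeneous_span_of_forall_mem _ Δ D hΔ⟩) y).IsPrime ∧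
      IsRegularLocalRing ((Proj (homogeneousSubmodule (Fin (n + 1)) k)).presheaf.stalk y ⧸
        stalkIdeal (projIdealSheaf (homogeneousSubmodule (Fin (n + 1)) k)
          ⟨Ideal.span (Set.range Δ), isHomogeneous_span_of_forall_mem _ Δ D hΔ⟩) y) := by
  set C := projIdealSheaf (homogeneousSubmodule (Fin (n + 1)) k)
    ⟨Ideal.span (Set.range Δ), isHomogeneous_span_of_forall_mem _ Δ D hΔ⟩ with hC
  haveI : IsRegularLocalRing ((Proj (homogeneousSubmodule (Fin (n + 1)) k)).presheaf.stalk y) :=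
    isRegular_projectiveSpace n k y
  set F : Fin 2 → (Proj (homogeneousSubmodule (Fin (n + 1)) k)).presheaf.stalk y := fun l =>
    ((Proj (homogeneousSubmodule (Fin (n + 1)) k)).presheaf.germ
        (Proj.basicOpen (homogeneousSubmodule (Fin (n + 1)) k) (X i)) y hyi).hom
      ((Proj.awayToSection (homogeneousSubmodule (Fin (n + 1)) k) (X i)).hom
        (mk₁ (homogeneousSubmodule (Fin (n + 1)) k) (CILift.X_mem_one' i) (D (![a, b] l)) (Δ (![a, b] l))
          (hΔ (![a, b] l)))) with hFdef
  have hle : stalkIdeal C y ≤ maximalIdeal _ := (mem_support_iff_stalkIdeal_le C y).mp hy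
  have hFC : ∀ l, F l ∈ stalkIdeal C y := by
    intro l
    rw [hC, CILift.stalkIdeal_projIdealSheaf_span Δ D hΔ i y hyi]
    exact Ideal.subset_span ⟨![a, b] l, rfl⟩
  have hF𝔪 : ∀ l, F l ∈ maximalIdeal _ := fun l => hle (hFC l)
  have hli := linearIndependent_toCotangent_of_forall_family F hF𝔪 hJy
  -- the stalk is `I_t` of the germ matrix
  have hstalk := stalkIdeal_projIdealSheaf_rowMinors M Δ hΔdef D hΔ i y hyi
  rw [← hC] at hstalk
  rw [hstalk] at hFC hle ⊢
  exact (minorsIdeal_pair_package_of_linearIndependent _ hF𝔪 hli hFC hle).2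

variable
  (hJ : ∀ y ∈ (projIdealSheaf (homogeneousSubmodule (Fin (n + 1)) k)
      ⟨Ideal.span (Set.range Δ), isHomogeneous_span_of_forall_mem _ Δ D hΔ⟩).support,
    ∃ (i : Fin (n + 1)) (hyi : y ∈ Proj.basicOpen (homogeneousSubmodule (Fin (n + 1)) k) (X i)) (a b : Fin (t + 1)),
      ∀ c : Fin 2 → (Proj (homogeneousSubmodule (Fin (n + 1)) k)).presheaf.stalk y,
        ∑ l, c l * ((Proj (homogeneousSubmodule (Fin (n + 1)) k)).presheaf.germ
            (Proj.basicOpen (homogeneousSubmodule (Fin (n + 1)) k) (X i)) y hyi).hom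
          ((Proj.awayToSection (homogeneousSubmodule (Fin (n + 1)) k) (X i)).hom
            (mk₁ (homogeneousSubmodule (Fin (n + 1)) k) (CILift.X_mem_one' i) (D (![a, b] l))
              (Δ (![a, b] l)) (hΔ (![a, b] l)))) ∈
          maximalIdeal ((Proj (homogeneousSubmodule (Fin (n + 1)) k)).presheaf.stalk y) ^ 2 →
        ∀ l, c l ∈ maximalIdeal ((Proj (homogeneousSubmodule (Fin (n + 1)) k)).presheaf.stalk y))

include hΔdef hJ in
/-- **`V((Δ)~)` is a REGULAR scheme under (J′-pair)** (regular quotient stalks, Literature `Scheme.isRegular_subscheme_of_forall`).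
[cite: Matsumura1987, Thm. 13.10 and Thm. 14.2] -/
theorem isRegular_subscheme_projIdealSheaf_rowMinors :
    Scheme.IsRegular (projIdealSheaf (homogeneousSubmodule (Fin (n + 1)) k)
      ⟨Ideal.span (Set.range Δ), isHomogeneous_span_of_forall_mem _ Δ D hΔ⟩).subscheme := by
  obtain ⟨hsm, -⟩ := stub_projectiveAmbientSmoothProper k n
  haveI : IsLocallyNoetherian (Proj (homogeneousSubmodule (Fin (n + 1)) k)) := by
    haveI := hsm
    exact LocallyOfFiniteType.isLocallyNoetherian
      (Proj.toSpecZero (homogeneousSubmodule (Fin (n + 1)) k) ≫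
        Spec.map (CommRingCat.ofHom (algebraMap k ((homogeneousSubmodule (Fin (n + 1)) k) 0))))
  refine Scheme.isRegular_subscheme_of_forall _ fun y hy => ?_
  obtain ⟨i, hyi, a, b, hJy⟩ := hJ y hy
  exact (isPrime_stalkIdeal_projIdealSheaf_rowMinors M Δ hΔdef D hΔ y hy i hyi a b hJy).2

include hΔdef hJ in
/-- **`V((Δ)~) → Spec k` is SMOOTH** for `k` perfect, under (J′-pair) (regular + locally of finite type over a perfect field, Stacks 00TV;
pattern of res-type-051's `CILift.smooth_subschemeι_projIdealSheaf_of_jacobian`). [cite: StacksProject, Tag 00TV] -/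
theorem smooth_subschemeι_projIdealSheaf_rowMinors [PerfectField k] :
    Smooth ((projIdealSheaf (homogeneousSubmodule (Fin (n + 1)) k)
        ⟨Ideal.span (Set.range Δ), isHomogeneous_span_of_forall_mem _ Δ D hΔ⟩).subschemeι ≫
      (Proj.toSpecZero (homogeneousSubmodule (Fin (n + 1)) k) ≫
        Spec.map (CommRingCat.ofHom (algebraMap k ((homogeneousSubmodule (Fin (n + 1)) k) 0))))) := by
  obtain ⟨hsm, -⟩ := stub_projectiveAmbientSmoothProper k n
  haveI := hsm
  haveI : LocallyOfFiniteType ((projIdealSheaf (homogeneousSubmodule (Fin (n + 1)) k)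
        ⟨Ideal.span (Set.range Δ), isHomogeneous_span_of_forall_mem _ Δ D hΔ⟩).subschemeι ≫
      (Proj.toSpecZero (homogeneousSubmodule (Fin (n + 1)) k) ≫
        Spec.map (CommRingCat.ofHom (algebraMap k ((homogeneousSubmodule (Fin (n + 1)) k) 0))))) := inferInstance
  exact smooth_of_isRegular_of_perfectField _ (isRegular_subscheme_projIdealSheaf_rowMinors M Δ hΔdef D hΔ hJ)

include hΔdef hJ in
/-- **hKEY EXACTNESS for the determinantal scheme: `(Δ)~ = 𝓘_Σ`** on `ℙⁿ_k`, `Σ = {y | ∀ l, Δ_l ∈ 𝔮_y}` (for any closedness proof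
`hSig`): under (J′-pair) every stalk on the support is prime, hence radical (res-D-pv-027's `eq_vanishingIdeal_support_of_forall_radical_le`,
`support_projIdealSheaf_span`). [cite: Hartshorne1977, II Cor. 5.16; Matsumura1987, Thm. 13.10] -/
theorem projIdealSheaf_rowMinors_eq_vanishingIdeal
    (hSig : IsClosed {y : Proj (homogeneousSubmodule (Fin (n + 1)) k) |
      ∀ l, Δ l ∈ (y : ProjectiveSpectrum (homogeneousSubmodule (Fin (n + 1)) k)).asHomogeneousIdeal}) :
    projIdealSheaf (homogeneousSubmodule (Fin (n + 1)) k)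
        ⟨Ideal.span (Set.range Δ), isHomogeneous_span_of_forall_mem _ Δ D hΔ⟩ =
      Scheme.IdealSheafData.vanishingIdeal
        ⟨{y : Proj (homogeneousSubmodule (Fin (n + 1)) k) |
          ∀ l, Δ l ∈ (y : ProjectiveSpectrum (homogeneousSubmodule (Fin (n + 1)) k)).asHomogeneousIdeal}, hSig⟩ := by
  -- adapted from res-D-pv-027's `CILift.projIdealSheaf_span_eq_vanishingIdeal` (p521354), primeness from §2
  have hsupp : (⟨{y : Proj (homogeneousSubmodule (Fin (n + 1)) k) |
      ∀ l, Δ l ∈ (y : ProjectiveSpectrum (homogeneousSubmodule (Fin (n + 1)) k)).asHomogeneousIdeal}, hSig⟩ :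
      Closeds (Proj (homogeneousSubmodule (Fin (n + 1)) k))) =
      (projIdealSheaf (homogeneousSubmodule (Fin (n + 1)) k)
        ⟨Ideal.span (Set.range Δ), isHomogeneous_span_of_forall_mem _ Δ D hΔ⟩).support :=
    Closeds.ext (CILift.support_projIdealSheaf_span Δ D hΔ).symm
  rw [hsupp]
  refine CILift.eq_vanishingIdeal_support_of_forall_radical_le _ fun y hy => ?_
  obtain ⟨i, hyi, a, b, hJy⟩ := hJ y hy
  exact (isPrime_stalkIdeal_projIdealSheaf_rowMinors M Δ hΔdef D hΔ y hy i hyi a b hJy).1.isRadical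

/-! ### From the polynomial-level JACOBIAN-PAIR clause to (J′-pair) -/

include hΔ in
/-- The pair `(Δ_a, Δ_b)` as a `Fin 2`-family of forms of degrees `(D_a, D_b)`. Plumbing. [folklore] -/
theorem pair_mem (a b : Fin (t + 1)) : ∀ l : Fin 2, ![Δ a, Δ b] l ∈ homogeneousSubmodule (Fin (n + 1)) k (![D a, D b] l) := by
  intro l
  fin_cases l
  · exact hΔ a
  · exact hΔ b

/-- **(J) ⇒ (J′-pair)**: the polynomial-level JACOBIAN-PAIR clause «at every `y ∈ Σ` some pair of maximal minors `Δ_a, Δ_b` has a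
non-vanishing `2 × 2` Jacobian minor `det (∂(Δ_a, Δ_b)/∂(x_{e 0}, x_{e 1})) ∉ 𝔮_y`» implies the stalk-level pair hypothesis (J′-pair) at every
point of `supp (Δ)~`, on a chart through the point — res-type-051's CI-JAC `CILift.downstairs_stalk_of_jacobian` with `c = 2` (Euler's identity
and Matsumura 30.4 live there). [cite: Matsumura1987, Thm. 30.4] -/
theorem pairDown_of_jacobianPair
    (hjac : ∀ y : Proj (homogeneousSubmodule (Fin (n + 1)) k), (∀ l, Δ l ∈ y.asHomogeneousIdeal) →
      ∃ (a b : Fin (t + 1)) (e : Fin 2 ↪ Fin (n + 1)),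
        (Matrix.of fun r s => pderiv (e s) (![Δ a, Δ b] r)).det ∉ y.asHomogeneousIdeal) :
    ∀ y ∈ (projIdealSheaf (homogeneousSubmodule (Fin (n + 1)) k)
        ⟨Ideal.span (Set.range Δ), isHomogeneous_span_of_forall_mem _ Δ D hΔ⟩).support,
      ∃ (i : Fin (n + 1)) (hyi : y ∈ Proj.basicOpen (homogeneousSubmodule (Fin (n + 1)) k) (X i)) (a b : Fin (t + 1)),
        ∀ c : Fin 2 → (Proj (homogeneousSubmodule (Fin (n + 1)) k)).presheaf.stalk y,
          ∑ l, c l * ((Proj (homogeneousSubmodule (Fin (n + 1)) k)).presheaf.germ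
              (Proj.basicOpen (homogeneousSubmodule (Fin (n + 1)) k) (X i)) y hyi).hom
            ((Proj.awayToSection (homogeneousSubmodule (Fin (n + 1)) k) (X i)).hom
              (mk₁ (homogeneousSubmodule (Fin (n + 1)) k) (CILift.X_mem_one' i) (D (![a, b] l))
                (Δ (![a, b] l)) (hΔ (![a, b] l)))) ∈
            maximalIdeal ((Proj (homogeneousSubmodule (Fin (n + 1)) k)).presheaf.stalk y) ^ 2 →
          ∀ l, c l ∈ maximalIdeal ((Proj (homogeneousSubmodule (Fin (n + 1)) k)).presheaf.stalk y) := by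
  intro y hy
  have hΔy : ∀ l, Δ l ∈ y.asHomogeneousIdeal := CILift.mem_asHomogeneousIdeal_of_mem_support_projIdealSheaf Δ D hΔ y hy
  obtain ⟨a, b, e, hdet⟩ := hjac y hΔy
  obtain ⟨i, hi⟩ := CILift.exists_X_not_mem y
  have hyi : y ∈ Proj.basicOpen (homogeneousSubmodule (Fin (n + 1)) k) (X i) := hi
  have hpy : ∀ l : Fin 2, ![Δ a, Δ b] l ∈ y.asHomogeneousIdeal := by
    intro l; fin_cases l
    · exact hΔy a
    · exact hΔy b
  have hdown := CILift.downstairs_stalk_of_jacobian ![Δ a, Δ b] ![D a, D b] (pair_mem Δ D hΔ a b) y hpy ⟨e, hdet⟩ i hyi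
  refine ⟨i, hyi, a, b, fun c hc => hdown c ?_⟩
  rw [Fin.sum_univ_two] at hc ⊢
  exact hc

end Downstairs

end DetLift

end Summit.ResolutionOfSingularities.ResolutionOfSingularities.Cruxes.EquisingularLiftNat.Sections

end
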